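import Summits.CriticalPhenomena.CardyFormulaZ2.Theorems.CardyFlipRussoSquareFromVoronoiHubDilutionDefs
import Summits.CriticalPhenomena.CardyFormulaZ2.Theorems.CardyFlipRussoSquareFromVoronoiHubFaithfulPart1
import Mathlib.Analysis.Convex.Segment
import HarnessLib

/-!
# Stub `stub_latticeNoTouch` of the line `poisson-dilution-leg`, crux `SquareFromVoronoiHub`
# (stmt-CriticalPhenomena-6434, route `CardyFlipRusso`, sub-problem `CardyFormulaZ2`)

The LOCAL NO-TOUCH LEMMA of the lattice end of the Poisson-dilution leg
(`…CardyFlipRussoSquareFromVoronoiHubDilutionDefs.lean`), in lattice units: a point of the segment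
between the positions of two equal or `G_s`-adjacent OPEN vertices of the `G_s` configuration
`gsConfig θ` (black lattice sites `Sum.inl v`, `v ∈ θ.1`; black-coined face centres `Sum.inr f`,
`hubCoin f ∈ θ.2`) never lies in the WHITE region `latBlack (latFlip θ)` = (union of the closed unit
squares about the white sites) minus (the face centres whose hub coin is black).  Elementary plane
geometry, coordinate by coordinate:

* the reduction `not_mem_latBlack_latFlip`: it suffices that every lattice site whose closed unit
  square contains the point is black, unless the point is a black-coined face centre;
* a black site lies in no white square, a black-coined centre is removed from the white region
  (the two `u = v` cases);
* `edge_coord`: an integer within `1/2` of a convex combination of two integers at distance `≤ 1`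
  is one of them — so a point of a `ℤ²` edge between black sites lies only in their two squares
  (`noTouch_inl_inl`, which also covers `u = v = Sum.inl x`);
* `corner_coord`: an integer within `1/2` of a point at distance `< 1/2` of an integer is that
  integer — so the half-diagonal from a black site `x` to a black-coined corner `c` of its square
  stays, before reaching `c`, in points whose only closed unit square is the one about `x`, and its
  endpoint `c` is removed from the white region (`noTouch_inl_inr`);
* two face centres are never adjacent (`not_Gs_adj_inr_inr`).

References: B. Bollobás, O. Riordan, *Percolation* (CUP 2006), Ch. 8 §8.1 (cells and colouring
conventions); the line card `Cruxes/SquareFromVoronoiHub/Lines/poisson_dilution_leg.md`.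
-/

noncomputable section

open scoped Topology
open MeasureTheory Metric Set Filter
open Literature.Analysis.FunctionSpaces (PointConfig IsPoissonPointProcess
  existsUnique_isPoissonPointProcess_holds)
open Literature.Probability.Percolation (SiteConfig sitePercolation half blackRegion voronoiCrossing)
open Literature.Probability.RandomPlanarGeometry (ConformalRectangle cardyFunction crossRatio)
open Summit.CriticalPhenomena.CardyFormulaZ2.Cruxes.SquareFromVoronoiHub.VoronoiBlocks
  (zGs Gs crudeCrossing siteCrossingProb voronoiCrossingProb squareFromVoronoiHub_iff)

namespace Summit.CriticalPhenomena.CardyFormulaZ2.Cruxes.SquareFromVoronoiHub.PoissonDilutionLeg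

open Summit.CriticalPhenomena.CardyFormulaZ2.Cruxes.SquareFromVoronoiHub.VoronoiBlocks.Faithful

/-! ### Integer bookkeeping -/

/-- Two integers at real distance `< 1` are equal. [folklore] -/
private theorem int_eq_of_abs_sub_lt_one {a b : ℤ} (h : |(a : ℝ) - b| < 1) : a = b := by
  rw [abs_lt] at h
  have h1 : ((a - b : ℤ) : ℝ) < 1 := by push_cast; linarith
  have h2 : (-1 : ℝ) < ((a - b : ℤ) : ℝ) := by push_cast; linarith
  have h1' : a - b < 1 := by exact_mod_cast h1
  have h2' : -1 < a - b := by exact_mod_cast h2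
  omega

/-- An integer `w` within `1/2` of a real number `m` at distance `< 1/2` from the integer `a` is `a`.
[folklore] -/
private theorem int_eq_of_abs_lt {a w : ℤ} {m : ℝ} (hm : |m - a| < 1 / 2) (h : |m - w| ≤ 1 / 2) :
    w = a := by
  refine (int_eq_of_abs_sub_lt_one ?_).symm
  calc |(a : ℝ) - w| ≤ |(a : ℝ) - m| + |m - w| := abs_sub_le _ _ _
    _ < 1 / 2 + 1 / 2 := add_lt_add_of_lt_of_le (by rwa [abs_sub_comm]) h
    _ = 1 := by norm_num

/-- **Edge coordinate.**  For integers `a`, `b` with `|b - a| ≤ 1` and `t ∈ [0, 1]`, an integer `w`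
within `1/2` of the convex combination `a + t (b - a)` is `a` or `b`. [folklore] -/
private theorem edge_coord {a b w : ℤ} {t : ℝ} (ht0 : 0 ≤ t) (ht1 : t ≤ 1)
    (hab : -1 ≤ b - a ∧ b - a ≤ 1) (h : |(a : ℝ) + t * ((b : ℝ) - a) - w| ≤ 1 / 2) :
    w = a ∨ w = b := by
  rw [abs_le] at h
  rcases (show b - a = -1 ∨ b - a = 0 ∨ b - a = 1 by omega) with e | e | e
  · have e' : (b : ℝ) - a = -1 := by exact_mod_cast e
    rw [e'] at h
    have h1 : (w : ℝ) < a + 1 := by linarith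
    have h2 : (a : ℝ) - 2 < w := by linarith
    have h1' : w < a + 1 := by exact_mod_cast h1
    have h2' : a - 2 < w := by exact_mod_cast h2
    omega
  · have e' : (b : ℝ) - a = 0 := by exact_mod_cast e
    rw [e'] at h
    have h1 : (w : ℝ) < a + 1 := by linarith
    have h2 : (a : ℝ) - 1 < w := by linarith
    have h1' : w < a + 1 := by exact_mod_cast h1
    have h2' : a - 1 < w := by exact_mod_cast h2
    omega
  · have e' : (b : ℝ) - a = 1 := by exact_mod_cast e
    rw [e'] at h
    have h1 : (w : ℝ) < a + 2 := by linarith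
    have h2 : (a : ℝ) - 1 < w := by linarith
    have h1' : w < a + 2 := by exact_mod_cast h1
    have h2' : a - 1 < w := by exact_mod_cast h2
    omega

/-- **Corner coordinate.**  For integers `a`, `c` with `a - c ∈ {0, 1}` (so that `c + 1/2 = a ± 1/2`)
and `t ∈ [0, 1)`, an integer `w` within `1/2` of `a + t (c + 1/2 - a)` is `a`. [folklore] -/
private theorem corner_coord {a c w : ℤ} {t : ℝ} (ht0 : 0 ≤ t) (ht1 : t < 1)
    (hac : a - c = 0 ∨ a - c = 1) (h : |(a : ℝ) + t * ((c : ℝ) + 1 / 2 - a) - w| ≤ 1 / 2) :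
    w = a := by
  have hc : (c : ℝ) + 1 / 2 - a = 1 / 2 ∨ (c : ℝ) + 1 / 2 - a = -(1 / 2) := by
    rcases hac with e | e
    · left
      have e' : (a : ℝ) = c := by exact_mod_cast (by omega : a = c)
      linarith
    · right
      have e' : (a : ℝ) = c + 1 := by exact_mod_cast (by omega : a = c + 1)
      linarith
  rcases hc with hc | hc <;> rw [hc] at h <;> refine int_eq_of_abs_lt ?_ h <;> rw [abs_lt] <;>
    constructor <;> linarith

/-- The integer solutions of `a² + b² = 1`: `|a|, |b| ≤ 1` and one of them vanishes. [folklore] -/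
private theorem sq_add_sq_eq_one {a b : ℤ} (h : a ^ 2 + b ^ 2 = 1) :
    (-1 ≤ a ∧ a ≤ 1) ∧ (-1 ≤ b ∧ b ≤ 1) ∧ (a = 0 ∨ b = 0) := by
  have ha : |a| ≤ 1 := by rw [← sq_le_one_iff_abs_le_one]; nlinarith [sq_nonneg b]
  have hb : |b| ≤ 1 := by rw [← sq_le_one_iff_abs_le_one]; nlinarith [sq_nonneg a]
  refine ⟨abs_le.mp ha, abs_le.mp hb, ?_⟩
  by_contra hne
  rw [not_or] at hne
  have ha' : 1 ≤ a ^ 2 := (one_le_sq_iff_one_le_abs a).mpr (Int.one_le_abs hne.1)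
  have hb' : 1 ≤ b ^ 2 := (one_le_sq_iff_one_le_abs b).mpr (Int.one_le_abs hne.2)
  linarith

/-! ### The reduction and the three geometric cases -/

/-- **Reduction.**  A point `z` is not in the white region `latBlack (latFlip θ)` as soon as every
lattice site whose closed unit square contains `z` is black, unless `z` is a face centre whose hub
coin is black. [folklore] -/
theorem not_mem_latBlack_latFlip {θ : LatConfig} {z : ℂ}
    (h : ∀ w : ℤ × ℤ, |z.re - w.1| ≤ 1 / 2 → |z.im - w.2| ≤ 1 / 2 →
      w ∈ θ.1 ∨ ∃ f : ℤ × ℤ, hubCoin f ∈ θ.2 ∧ z = zGs (Sum.inr f)) :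
    z ∉ latBlack (latFlip θ) := by
  rintro ⟨⟨w, hw, h1, h2⟩, hz⟩
  rcases h w h1 h2 with hw' | ⟨f, hf, rfl⟩
  · exact hw hw'
  · exact hz ⟨f, not_not_intro hf, rfl⟩

/-- **Site–site case** (covers `u = v = Sum.inl x`): a point of the segment between two equal or
adjacent black sites `x`, `y` lies in no white square — a closed unit square about `w` containing it
has `w ∈ {x, y}` (`edge_coord` in each coordinate; adjacent sites differ in one coordinate only).
[folklore] -/
theorem noTouch_inl_inl {θ : LatConfig} {x y : ℤ × ℤ} (hx : x ∈ θ.1) (hy : y ∈ θ.1)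
    (hxy : (Sum.inl x : (ℤ × ℤ) ⊕ (ℤ × ℤ)) = Sum.inl y ∨ Gs.Adj (Sum.inl x) (Sum.inl y)) {z : ℂ}
    (hz : z ∈ segment ℝ (zGs (Sum.inl x)) (zGs (Sum.inl y))) : z ∉ latBlack (latFlip θ) := by
  have hd : (-1 ≤ y.1 - x.1 ∧ y.1 - x.1 ≤ 1) ∧ (-1 ≤ y.2 - x.2 ∧ y.2 - x.2 ≤ 1) ∧
      (x.1 = y.1 ∨ x.2 = y.2) := by
    rcases hxy with h | h
    · cases h
      omega
    · obtain ⟨h1, h2, h3⟩ := sq_add_sq_eq_one (Gs_adj_inl_inl_iff.mp h)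
      omega
  rw [segment_eq_image'] at hz
  obtain ⟨t, ⟨ht0, ht1⟩, rfl⟩ := hz
  refine not_mem_latBlack_latFlip fun w h1 h2 => Or.inl ?_
  simp only [Complex.add_re, Complex.add_im, Complex.smul_re, Complex.smul_im, Complex.sub_re,
    Complex.sub_im, smul_eq_mul, zGs_re_inl, zGs_im_inl] at h1 h2
  have e1 := edge_coord ht0 ht1 hd.1 h1
  have e2 := edge_coord ht0 ht1 hd.2.1 h2
  obtain rfl | rfl : w = x ∨ w = y := by
    rcases hd.2.2 with h | h
    · rcases e2 with e2 | e2
      · exact Or.inl (Prod.ext (by omega) e2)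
      · exact Or.inr (Prod.ext (by omega) e2)
    · rcases e1 with e1 | e1
      · exact Or.inl (Prod.ext e1 (by omega))
      · exact Or.inr (Prod.ext e1 (by omega))
  exacts [hx, hy]

/-- **Site–centre case**: a point of the half-diagonal from a black site `x` to a black-coined corner
`c = zGs (Sum.inr f)` of its square either is `c` — removed from the white region — or lies at
sup-distance `< 1/2` from `x`, hence in no closed unit square but the (black) one about `x`
(`corner_coord` in each coordinate). [folklore] -/
theorem noTouch_inl_inr {θ : LatConfig} {x f : ℤ × ℤ} (hx : x ∈ θ.1) (hf : hubCoin f ∈ θ.2)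
    (hadj : Gs.Adj (Sum.inl x) (Sum.inr f)) {z : ℂ}
    (hz : z ∈ segment ℝ (zGs (Sum.inl x)) (zGs (Sum.inr f))) : z ∉ latBlack (latFlip θ) := by
  rw [Gs_adj_inl_inr_iff] at hadj
  rw [segment_eq_image'] at hz
  obtain ⟨t, ⟨ht0, ht1⟩, rfl⟩ := hz
  rcases eq_or_lt_of_le ht1 with rfl | ht1'
  · refine not_mem_latBlack_latFlip fun _ _ _ => Or.inr ⟨f, hf, ?_⟩
    simp
  · refine not_mem_latBlack_latFlip fun w h1 h2 => Or.inl ?_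
    simp only [Complex.add_re, Complex.add_im, Complex.smul_re, Complex.smul_im, Complex.sub_re,
      Complex.sub_im, smul_eq_mul, zGs_re_inl, zGs_im_inl, zGs_re_inr, zGs_im_inr] at h1 h2
    obtain rfl : w = x := Prod.ext (corner_coord ht0 ht1' hadj.1 h1) (corner_coord ht0 ht1' hadj.2 h2)
    exact hx

/-- **Stub (S/M): the local no-touch lemma.**  A point on the segment between two equal or
`Gs`-adjacent OPEN vertices of `gsConfig θ` (lattice units) is not in the WHITE region
`latBlack (latFlip θ)` (closed white squares minus the black-coined face centres): the centre of a black
square lies in no white square; a segment between edge-adjacent black squares stays in their union and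
meets a white square only if that square is one of them; the half-diagonal from a black site to a
black-coined corner stays in the black square except at the corner itself, which is removed from the
white region because its coin is black; a black-coined centre alone is removed likewise; and two
centres are never adjacent. [folklore] -/
theorem stub_latticeNoTouch : ∀ (θ : LatConfig) (u v : (ℤ × ℤ) ⊕ (ℤ × ℤ)), u ∈ gsConfig θ → v ∈ gsConfig θ →
    (u = v ∨ Gs.Adj u v) → ∀ z ∈ segment ℝ (zGs u) (zGs v), z ∉ latBlack (latFlip θ) := by
  intro θ u v hu hv huv z hz
  rcases huv with rfl | hadj
  · cases u with
    | inl x =>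
      have hx := (inl_mem_gsConfig θ x).1 hu
      exact noTouch_inl_inl hx hx (Or.inl rfl) hz
    | inr f =>
      rw [segment_same, mem_singleton_iff] at hz
      subst hz
      exact not_mem_latBlack_latFlip fun _ _ _ => Or.inr ⟨f, (inr_mem_gsConfig θ f).1 hu, rfl⟩
  · cases u with
    | inl x =>
      cases v with
      | inl y =>
        exact noTouch_inl_inl ((inl_mem_gsConfig θ x).1 hu) ((inl_mem_gsConfig θ y).1 hv) (Or.inr hadj) hz
      | inr f =>
        exact noTouch_inl_inr ((inl_mem_gsConfig θ x).1 hu) ((inr_mem_gsConfig θ f).1 hv) hadj hz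
    | inr f =>
      cases v with
      | inl x =>
        rw [segment_symm] at hz
        exact noTouch_inl_inr ((inl_mem_gsConfig θ x).1 hv) ((inr_mem_gsConfig θ f).1 hu) hadj.symm hz
      | inr g => exact absurd hadj (not_Gs_adj_inr_inr f g)

end Summit.CriticalPhenomena.CardyFormulaZ2.Cruxes.SquareFromVoronoiHub.PoissonDilutionLeg

end
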